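import Summits.AnomalousDissipation.Statement
import Summits.AnomalousDissipation.AnomalousDissipation.Theorems.EnsembleZerothLaw
import Literature.StrongHypotheses.AnomalousDissipation
import Literature.Analysis.FluidPDE.StatisticalSolutionsProofs
import HarnessLib
import HarnessLib.Audit.TribunalTags

/-!
# Summit `AnomalousDissipation` — bridges of the Strong-Hypothesis Library (D-0034, skeleton)

Summit-side BRIDGE file for the registry `Literature/StrongHypotheses/AnomalousDissipation.lean`: for every
`H` tagged there with `@[strong_hypothesis "AnomalousDissipation.AnomalousDissipation"]`, at most ONE bridge
tagged `@[summit_bridge "AnomalousDissipation.AnomalousDissipation"]`, concluding the ROOT problem decl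
`_root_.AnomalousDissipation` (`Summits/AnomalousDissipation/AnomalousDissipation/Statement.lean`;
`:= Literature.Turb.ZerothLaw`, unfolded by `anomalousDissipation_iff_exists_zerothLawAt` below).

* LANDED bridge (1): `anomalousDissipation_of_zerothLawEveryForce` — the every-force zeroth law
  (`Literature.StrongHypotheses.AnomalousDissipation.ZerothLawEveryForce`, Frisch 1995 Ch. 5 law (ii) / §6.1 H3
  for every stirring) implies the summit (`∃ f`) by instantiating at the Stokes eigenfield of
  `Literature.Analysis.FluidPDE.exists_isSmooth_isDivFree_hasZeroMean_ne_zero` (`StatisticalSolutionsProofs`).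
* NO bridge (`bridge: none`) for the three cognate readings `Literature.Analysis.FluidPDE.EnsembleZerothLaw`
  (ensemble form — the passage to a Leray–Hopf trajectory is the open crux `EnsembleRealization` of route
  `Ensemble`, not a printed theorem), `….BrueDeLellisQuestion22`, `….BrueDeLellisQuestion21` (finite-window
  classical-solution forms; neither direction in print). Writing a PRINTED bridge would cite a proof that does
  not exist (CONVENTIONS §4).
* Summit-side conjecture def tagged HERE: `Summit.AnomalousDissipation.AnomalousDissipation.EnsembleZerothLaw`
  (`Theorems/EnsembleZerothLaw.lean`, the gate-migrated verbatim copy of the Literature decl — same census row,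
  tagged so the tribunal recognises either name).

No new mathematics; no `sorry`, no axiom.
-/

/-! ## Summit-side conjecture defs, tagged in place -/

attribute [strong_hypothesis "AnomalousDissipation.AnomalousDissipation"]
  Summit.AnomalousDissipation.AnomalousDissipation.EnsembleZerothLaw

noncomputable section

namespace Summit.AnomalousDissipation.StrongHypotheses

open Literature.StrongHypotheses.AnomalousDissipation

/-- Unfolding: the summit `_root_.AnomalousDissipation` (`:= Literature.Turb.ZerothLaw`) is
`∃ f, IsSmooth f ∧ IsDivFree f ∧ HasZeroMean f ∧ ZerothLawAt f` (definitional; `ZerothLawAt` is the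
registry's per-force predicate). [folklore] -/
theorem anomalousDissipation_iff_exists_zerothLawAt :
    _root_.AnomalousDissipation ↔
      ∃ f : UnitAddTorus (Fin 3) → EuclideanSpace ℝ (Fin 3),
        Literature.Analysis.FunctionSpaces.Torus.IsSmooth f ∧
        Literature.Analysis.FunctionSpaces.Torus.IsDivFree f ∧
        Literature.Analysis.FunctionSpaces.Torus.HasZeroMean f ∧ ZerothLawAt f :=
  Iff.rfl

/-! ## Strictly stronger hypothesis (landed bridge) -/

/-- **Every-force zeroth law ⟹ summit** (landed): instantiate `ZerothLawEveryForce` at a smooth,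
divergence-free, mean-zero, non-zero force (a Stokes eigenfield,
`Literature.Analysis.FluidPDE.exists_isSmooth_isDivFree_hasZeroMean_ne_zero`). Frisch's law (ii) for every
stirring implies it for some stirring. [cite: FrischTurbulence1995, Ch. 5 law (ii) and §6.1 H3] -/
@[summit_bridge "AnomalousDissipation.AnomalousDissipation"]
theorem anomalousDissipation_of_zerothLawEveryForce (h : ZerothLawEveryForce) :
    _root_.AnomalousDissipation := by
  obtain ⟨f, hs, hd, hm, hne⟩ :=
    Literature.Analysis.FluidPDE.exists_isSmooth_isDivFree_hasZeroMean_ne_zero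
  exact anomalousDissipation_iff_exists_zerothLawAt.2 ⟨f, hs, hd, hm, h f hs hd hm hne⟩

end Summit.AnomalousDissipation.StrongHypotheses

end
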